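import Literature.AnabelianGeometry.EtaleTheta.Discharge.Sec5OfConnectedTemperoid
import Literature.AnabelianGeometry.EtaleTheta.Discharge.Sec4Prop42SubRootsReading
import Literature.AnabelianGeometry.EtaleTheta.Discharge.Sec4Prop42SubRootLawTreeVocab
import Literature.AnabelianGeometry.EtaleTheta.Discharge.Sec4Prop42SubRootLawTreeVocabWeak

/-!
# [EtTh] Prop 4.2 (iii) ∧ (iv) over the GENUINE CONNECTED base `D := B^temp(Π^tp_X)⁰` — the Def 4.1 (ii)
# naturality law `hS` DISCHARGED

Mochizuki, *The étale theta function and its Frobenioid-theoretic manifestations*, Publ. RIMS **45** (2009), §4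
Prop 4.2 (iii)(iv), statement PDF pp.88–89, proof pp.89–90; Def 4.1 (ii) PDF p.87 («natural surjective outer
homomorphism `Π^tp_X ↠ Gal(A)`»); Def 3.6 (ii) PDF p.76 (`D` connected, totally epimorphic)
[cite: MochizukiEtTh2009, Prop 4.2 p.88].  abc-iut cell, layer L2, cone nodes `EtTh:Prop4.2(iii)`, `EtTh:Prop4.2(iv)`
(plan/L2/SUBDAG-EtTh-Prop42.md «SUBDAG DONE to floor» at the abstract canonical model).  Seat abc-iut-w6-d037 (gen 4).
PROOF-ONLY (0 `def`s); nothing landed is edited or restated — every theorem below is a BY-NAME instantiation.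

The Prop 4.2 (iii)/(iv) closers of record (abc-iut-w4-d044 / abc-iut-w5-d134 / this seat's gen 2) are stated at
abc-iut-L2-t9's canonical model `BiKummerSetting.mkOfModelCanonical X tf hZ hP IG gS gSs NH A₀ hA₀ hA₀'` over an
ARBITRARY base `D` with free Galois-object predicate `IG` and free Galois surjections `gS`, and carry the Def 4.1 (ii)
naturality LAW
  `hS : ∀ A B (Galois) (b : B ⟶ A), ∃ c : Π^tp_X, ∀ g, gS_B(g) ≫ b = b ≫ gS_A(c g c⁻¹)`
as a binder.  Over print's base `D := B^temp(Π^tp_X)⁰ = ConnectedPart (BTemp X.Pi)` the §4 setting is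
abc-iut-L2-t4's `BiKummerSetting.mkOfConnectedTemperoid X tf hZ hP NH A₀ hA₀ hA₀'` (`Discharge/Sec5OfConnectedTemperoid.lean`,
= `mkOfModelCanonical` with `IG A := IsGaloisObj A.obj` ([SemiAnbd] Def 3.1 (iv)) and `gS :=` the Galois surjections
`galoisSurjOf` ([SemiAnbd] Rmk 3.1.3) read in the full subcategory), and there `hS` is the THEOREM
`BiKummerSetting.mkOfConnectedTemperoid_galoisSurj_natural` (abc-iut-w5-d013's `galoisSurjOf_natural`).  Hence, at the
same base as the Thm 4.4 end knit (`BiKummerThm44SubModelConnectedOfGaloisCovering.lean`) and as abc-iut-w6-d053's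
Prop 5.2 (i) / Rmk 4.3.2 instantiation (`Sec5RootTransitionsOfConnectedTemperoid.lean`):
* §1 (any [FrdI] vocabulary `V`, any base-category vocabulary `VD`):
  `prop42_iii_mkOfConnectedTemperoid_of_laws` — (iii) ⇐ {`Φ` divisorial, `hDSpull`, `hR`, `hE`};
  `prop42_iii_iv_mkOfConnectedTemperoid_of_laws` — (iii) ∧ (iv) ⇐ {`Φ` divisorial, `hDSpull`, `hR`, `hE`, `hL`};
  `prop42_iii_iv_mkOfConnectedTemperoid_of_baseRootLaw` — the E2 root law `hR` reduced to the `B₀^Λ`-level law `hR₀` +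
  `hTF` (G-w4d044-3): ⇐ {`Φ` divisorial, `hDSpull`, `hTF`, `hR₀`, `hE`, `hL`};
  `prop42_iii_iv_mkOfConnectedTemperoid_rootsReading` — the `NH`-FREE floor at the ROOTS READING of the
  `(N, H_⊙^{bs-fld})`-saturation slot: ⇐ {`Φ` divisorial, `hDSpull`, `hR`, `hK`};
* §2 over the canonical base-category vocabulary `treeCatVocab` ("`Φ` divisorial" = the Def 3.6 (ii) field):
  `…_of_laws_treeCatVocab` ⇐ {`hDSpull`, `hR`, `hE`, `hL`} and `…_rootsReading_treeCatVocab` ⇐ {`hDSpull`, `hR`, `hK`};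
* §3 over the canonical [FrdI] vocabularies `treeMonoidVocab` / `treeMonoidVocabWeak` (`hTF` a THEOREM, abc-iut-w4-d044 /
  this seat's gen 2): `…_of_baseRootLaw_treeVocab`, `…_of_baseRootLaw_treeVocabWeak` ⇐ {`Φ` divisorial, `hDSpull`, `hR₀`,
  `hE`, `hL`}, and `…_of_baseRootLaw_treeCatVocabWeak` ⇐ {`hDSpull`, `hR₀`, `hE`, `hL`}.
The remaining binders are the base-level LAWS of plan/GAP-LEDGER.md (G-w4d044-1 `hL`, G-w4d044-2 `hE`, G-w4d044-3
`hR`/`hR₀`) and the [FrdI] Prop 4.1 (iii) coprimality-pull-back law `hDSpull` — properties of the divisor / rational-function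
data of the given tempered Frobenioid `tf`, not of the base.  HONEST FRAMING: refereed pre-IUT material ([EtTh] 2009);
nothing here asserts that a tempered Frobenioid over `B^temp(Π^tp_X)⁰` arises from an actual curve; binders, not new `Prop`
facts (D-0067 (5)); nothing here bears on [IUTchIII] Cor 3.12; typed ≠ proved — here PROVED modulo the named laws.
-/

noncomputable section

namespace Literature.AnabelianGeometry.EtaleTheta

open CategoryTheory Opposite Literature.AlgebraicGeometry.Frobenioids Literature.AnabelianGeometry.SemiGraphs
  Literature.AnabelianGeometry.SemiGraphs.GaloisObjects Literature.AlgebraicGeometry.Frobenioids.QuasiTemperoid.BTempConnected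

universe u₀ v₀ w

namespace BiKummerSetting

/-! ## §1 Any [FrdI] vocabulary `V`, any base-category vocabulary `VD` -/

section General

variable {K : Type u₀} [Field K] (X : SemiGraphs.TemperedArithmeticGroup.{u₀} K) {D₀ : Type u₀} [Category.{v₀} D₀]
  {V : FrdIMonoidStub.{w}} {T₀ : RealifiedDivisorMonoids (D₀ := D₀) V}
  {VD : FrdICatStub.{u₀ + 1, u₀, w} (ConnectedPart (BTemp X.Pi))}
  (tf : TemperedFrobenioid T₀ (ConnectedPart (BTemp X.Pi)) VD) (hZ : tf.monoidType = MonoidType.Z)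
  (hP : ∀ A : (ConnectedPart (BTemp X.Pi))ᵒᵖ, IsPerfect (tf.Φ.carrier A))
  (NH : Subgroup (Field.absoluteGaloisGroup K) → tf.category → ℕ+ → Prop)
  (A₀ : tf.category) (hA₀ : PreFrobenioid.IsFrobeniusTrivial tf.toElem A₀) (hA₀' : SemiGraphs.IsGaloisObj A₀.base.obj)

/-- **[EtTh] Prop 4.2 (iii) AS TYPED over `B^temp(Π^tp_X)⁰`, modulo base-level laws only, `hS` DISCHARGED**: `Φ`
divisorial, the [FrdI] Prop 4.1 (iii) coprimality-pull-back law `hDSpull`, the E2 root law `hR` (G-w4d044-3) and the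
[FrdII] Rmk 2.2.1 refinement law `hE` (G-w4d044-2) — abc-iut-w4-d044's `Prop42Sub.prop42_iii_mkOfModelCanonical_of_laws`
with `hS := mkOfConnectedTemperoid_galoisSurj_natural`. [cite: MochizukiEtTh2009, Prop 4.2 p.88] -/
theorem Prop42Sub.prop42_iii_mkOfConnectedTemperoid_of_laws
    (hΦd : Objectwise (fun M _ => IsDivisorial M) tf.divisorMonoid)
    (hDSpull : ∀ {A A' : ConnectedPart (BTemp X.Pi)} (e : A' ⟶ A) {a b : tf.Φ.carrier (op A)},
      (∀ x : tf.Φ.carrier (op A), x ∣ a → x ∣ b → x = 1) →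
        ∀ y : tf.Φ.carrier (op A'), y ∣ pull tf.divisorMonoid e a → y ∣ pull tf.divisorMonoid e b → y = 1)
    (hR : ∀ (N : ℕ+) (A : ConnectedPart (BTemp X.Pi)), SemiGraphs.IsGaloisObj A.obj →
      ∀ f : tf.ratFnFunctor.obj (op A),
        ∃ (A' : ConnectedPart (BTemp X.Pi)) (_ : SemiGraphs.IsGaloisObj A'.obj) (b : A' ⟶ A)
          (g : tf.ratFnFunctor.obj (op A')), g ^ (N : ℕ) = pull tf.ratFnFunctor b f)
    (hE : ∀ (N : ℕ+) (A' : tf.category), PreFrobenioid.IsFrobeniusTrivial tf.toElem A' →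
      SemiGraphs.IsGaloisObj A'.base.obj →
        ∃ (A'' : tf.category) (ψ : A'' ⟶ A'), PreFrobenioid.IsPullbackMorphism tf.toElem ψ ∧
          SemiGraphs.IsGaloisObj A''.base.obj ∧ tf.IsMuSaturated A'' N ∧
            NH (mkOfConnectedTemperoid X tf hZ hP NH A₀ hA₀ hA₀').HodotBsFld A'' N) :
    (mkOfConnectedTemperoid X tf hZ hP NH A₀ hA₀ hA₀').Prop42_iii (fun {_ _} φ x => tf.pullFracModel φ x) :=
  Prop42Sub.prop42_iii_mkOfModelCanonical_of_laws X tf hZ hP _ _ _ NH A₀ hA₀ hA₀' hΦd hDSpull hR hE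
    (mkOfConnectedTemperoid_galoisSurj_natural X tf hZ hP NH A₀ hA₀ hA₀')

/-- **[EtTh] Prop 4.2 (iii) ∧ (iv) AS TYPED over `B^temp(Π^tp_X)⁰` — the JOINT FLOOR of DAG nodes `EtTh:Prop4.2(iii)` /
`(iv)` at the genuine base, `hS` DISCHARGED**: ⇐ {`Φ` divisorial, `hDSpull`, `hR` (G-w4d044-3), `hE` (G-w4d044-2), `hL`
(G-w4d044-1, the roots-of-constants law)} — abc-iut-w4-d044's `Prop42Sub.prop42_iii_iv_mkOfModelCanonical_of_laws` with
`hS := mkOfConnectedTemperoid_galoisSurj_natural`. [cite: MochizukiEtTh2009, Prop 4.2 p.88] -/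
theorem Prop42Sub.prop42_iii_iv_mkOfConnectedTemperoid_of_laws
    (hΦd : Objectwise (fun M _ => IsDivisorial M) tf.divisorMonoid)
    (hDSpull : ∀ {A A' : ConnectedPart (BTemp X.Pi)} (e : A' ⟶ A) {a b : tf.Φ.carrier (op A)},
      (∀ x : tf.Φ.carrier (op A), x ∣ a → x ∣ b → x = 1) →
        ∀ y : tf.Φ.carrier (op A'), y ∣ pull tf.divisorMonoid e a → y ∣ pull tf.divisorMonoid e b → y = 1)
    (hR : ∀ (N : ℕ+) (A : ConnectedPart (BTemp X.Pi)), SemiGraphs.IsGaloisObj A.obj →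
      ∀ f : tf.ratFnFunctor.obj (op A),
        ∃ (A' : ConnectedPart (BTemp X.Pi)) (_ : SemiGraphs.IsGaloisObj A'.obj) (b : A' ⟶ A)
          (g : tf.ratFnFunctor.obj (op A')), g ^ (N : ℕ) = pull tf.ratFnFunctor b f)
    (hE : ∀ (N : ℕ+) (A' : tf.category), PreFrobenioid.IsFrobeniusTrivial tf.toElem A' →
      SemiGraphs.IsGaloisObj A'.base.obj →
        ∃ (A'' : tf.category) (ψ : A'' ⟶ A'), PreFrobenioid.IsPullbackMorphism tf.toElem ψ ∧
          SemiGraphs.IsGaloisObj A''.base.obj ∧ tf.IsMuSaturated A'' N ∧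
            NH (mkOfConnectedTemperoid X tf hZ hP NH A₀ hA₀ hA₀').HodotBsFld A'' N)
    (hL : ∀ (A'' : tf.category) (N : ℕ+) (g : A''.base ⟶ A₀.base) (ξ : tf.ratFnFunctor.obj (op A₀.base)),
      PreFrobenioid.IsFrobeniusTrivial tf.toElem A'' →
      NH (mkOfConnectedTemperoid X tf hZ hP NH A₀ hA₀ hA₀').HodotBsFld A'' N →
      divB tf.divisorMonoid tf.ratFnFunctor tf.divBNatTrans (op A₀.base) ξ = 1 →
        ∃ ζ : tf.ratFnFunctor.obj (op A''.base), ζ ^ (N : ℕ) = pull tf.ratFnFunctor g ξ) :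
    (mkOfConnectedTemperoid X tf hZ hP NH A₀ hA₀ hA₀').Prop42_iii (fun {_ _} φ x => tf.pullFracModel φ x) ∧
      (mkOfConnectedTemperoid X tf hZ hP NH A₀ hA₀ hA₀').Prop42_iv (fun φ x => tf.pullFracModel φ x) :=
  Prop42Sub.prop42_iii_iv_mkOfModelCanonical_of_laws X tf hZ hP _ _ _ NH A₀ hA₀ hA₀' hΦd hDSpull hR hE
    (mkOfConnectedTemperoid_galoisSurj_natural X tf hZ hP NH A₀ hA₀ hA₀') hL

/-- **[EtTh] Prop 4.2 (iii) ∧ (iv) AS TYPED over `B^temp(Π^tp_X)⁰`, the E2 root law `hR` REPLACED by the `B₀^Λ`-level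
root law `hR₀` + injectivity of `N`-th powers in `(Φ^{ℝ-log})^gp` (`hTF`), `hS` DISCHARGED** — abc-iut-w4-d044's
`Prop42Sub.prop42_iii_iv_mkOfModelCanonical_of_baseRootLaw` (G-w4d044-3 reduction) with
`hS := mkOfConnectedTemperoid_galoisSurj_natural`. [cite: MochizukiEtTh2009, Prop 4.2 p.88] -/
theorem Prop42Sub.prop42_iii_iv_mkOfConnectedTemperoid_of_baseRootLaw
    (hΦd : Objectwise (fun M _ => IsDivisorial M) tf.divisorMonoid)
    (hDSpull : ∀ {A A' : ConnectedPart (BTemp X.Pi)} (e : A' ⟶ A) {a b : tf.Φ.carrier (op A)},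
      (∀ x : tf.Φ.carrier (op A), x ∣ a → x ∣ b → x = 1) →
        ∀ y : tf.Φ.carrier (op A'), y ∣ pull tf.divisorMonoid e a → y ∣ pull tf.divisorMonoid e b → y = 1)
    (hTF : ∀ (A : ConnectedPart (BTemp X.Pi)) (N : ℕ), 0 < N →
      Function.Injective fun x : Algebra.GrothendieckGroup (T₀.ΦR.obj (op (tf.base.obj A))) => x ^ N)
    (hR₀ : ∀ (N : ℕ+) (A : ConnectedPart (BTemp X.Pi)), SemiGraphs.IsGaloisObj A.obj →
      ∀ b : T₀.BΛ.obj (op (tf.base.obj A)),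
        ∃ (A' : ConnectedPart (BTemp X.Pi)) (_ : SemiGraphs.IsGaloisObj A'.obj) (c : A' ⟶ A)
          (b' : T₀.BΛ.obj (op (tf.base.obj A'))), b' ^ (N : ℕ) = (T₀.BΛ.map (tf.base.map c).op).hom b)
    (hE : ∀ (N : ℕ+) (A' : tf.category), PreFrobenioid.IsFrobeniusTrivial tf.toElem A' →
      SemiGraphs.IsGaloisObj A'.base.obj →
        ∃ (A'' : tf.category) (ψ : A'' ⟶ A'), PreFrobenioid.IsPullbackMorphism tf.toElem ψ ∧
          SemiGraphs.IsGaloisObj A''.base.obj ∧ tf.IsMuSaturated A'' N ∧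
            NH (mkOfConnectedTemperoid X tf hZ hP NH A₀ hA₀ hA₀').HodotBsFld A'' N)
    (hL : ∀ (A'' : tf.category) (N : ℕ+) (g : A''.base ⟶ A₀.base) (ξ : tf.ratFnFunctor.obj (op A₀.base)),
      PreFrobenioid.IsFrobeniusTrivial tf.toElem A'' →
      NH (mkOfConnectedTemperoid X tf hZ hP NH A₀ hA₀ hA₀').HodotBsFld A'' N →
      divB tf.divisorMonoid tf.ratFnFunctor tf.divBNatTrans (op A₀.base) ξ = 1 →
        ∃ ζ : tf.ratFnFunctor.obj (op A''.base), ζ ^ (N : ℕ) = pull tf.ratFnFunctor g ξ) :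
    (mkOfConnectedTemperoid X tf hZ hP NH A₀ hA₀ hA₀').Prop42_iii (fun {_ _} φ x => tf.pullFracModel φ x) ∧
      (mkOfConnectedTemperoid X tf hZ hP NH A₀ hA₀ hA₀').Prop42_iv (fun φ x => tf.pullFracModel φ x) :=
  Prop42Sub.prop42_iii_iv_mkOfModelCanonical_of_baseRootLaw X tf hZ hP _ _ _ NH A₀ hA₀ hA₀' hΦd hDSpull hTF hR₀ hE
    (mkOfConnectedTemperoid_galoisSurj_natural X tf hZ hP NH A₀ hA₀ hA₀') hL

/-- **[EtTh] Prop 4.2 (iii) ∧ (iv) AS TYPED over `B^temp(Π^tp_X)⁰` AT THE ROOTS READING of the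
`(N, H_⊙^{bs-fld})`-saturation slot (a reading WEAKER than print's cohomological [FrdII] Def 2.2 (ii)(c)) — the
`NH`-FREE floor, `hS` DISCHARGED**: ⇐ {`Φ` divisorial, `hDSpull`, the E2 root law `hR`, the Kummer-cover law `hK`
([FrdII] Rmk 2.2.1 + Def 2.1 (i))} — abc-iut-w4-d044's `Prop42Sub.prop42_iii_iv_mkOfModelCanonical_rootsReading` with
`hS := mkOfConnectedTemperoid_galoisSurj_natural`. [cite: MochizukiEtTh2009, Prop 4.2 p.88] -/
theorem Prop42Sub.prop42_iii_iv_mkOfConnectedTemperoid_rootsReading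
    (hΦd : Objectwise (fun M _ => IsDivisorial M) tf.divisorMonoid)
    (hDSpull : ∀ {A A' : ConnectedPart (BTemp X.Pi)} (e : A' ⟶ A) {a b : tf.Φ.carrier (op A)},
      (∀ x : tf.Φ.carrier (op A), x ∣ a → x ∣ b → x = 1) →
        ∀ y : tf.Φ.carrier (op A'), y ∣ pull tf.divisorMonoid e a → y ∣ pull tf.divisorMonoid e b → y = 1)
    (hR : ∀ (N : ℕ+) (A : ConnectedPart (BTemp X.Pi)), SemiGraphs.IsGaloisObj A.obj →
      ∀ f : tf.ratFnFunctor.obj (op A),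
        ∃ (A' : ConnectedPart (BTemp X.Pi)) (_ : SemiGraphs.IsGaloisObj A'.obj) (b : A' ⟶ A)
          (g : tf.ratFnFunctor.obj (op A')), g ^ (N : ℕ) = pull tf.ratFnFunctor b f)
    (hK : ∀ (N : ℕ+) (A' : tf.category), PreFrobenioid.IsFrobeniusTrivial tf.toElem A' →
      SemiGraphs.IsGaloisObj A'.base.obj →
        ∃ (A'' : tf.category) (ψ : A'' ⟶ A'), PreFrobenioid.IsPullbackMorphism tf.toElem ψ ∧
          SemiGraphs.IsGaloisObj A''.base.obj ∧ tf.IsMuSaturated A'' N ∧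
            ∀ (b : A''.base ⟶ A₀.base) (x : tf.ratFnFunctor.obj (op A₀.base)),
              divB tf.divisorMonoid tf.ratFnFunctor tf.divBNatTrans (op A₀.base) x = 1 →
                ∃ ζ : tf.ratFnFunctor.obj (op A''.base), ζ ^ (N : ℕ) = pull tf.ratFnFunctor b x) :
    (mkOfConnectedTemperoid X tf hZ hP
        (fun _ A M => ∀ (b : A.base ⟶ A₀.base) (x : tf.ratFnFunctor.obj (op A₀.base)),
          divB tf.divisorMonoid tf.ratFnFunctor tf.divBNatTrans (op A₀.base) x = 1 →
            ∃ ζ : tf.ratFnFunctor.obj (op A.base), ζ ^ (M : ℕ) = pull tf.ratFnFunctor b x)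
        A₀ hA₀ hA₀').Prop42_iii (fun {_ _} φ x => tf.pullFracModel φ x) ∧
      (mkOfConnectedTemperoid X tf hZ hP
        (fun _ A M => ∀ (b : A.base ⟶ A₀.base) (x : tf.ratFnFunctor.obj (op A₀.base)),
          divB tf.divisorMonoid tf.ratFnFunctor tf.divBNatTrans (op A₀.base) x = 1 →
            ∃ ζ : tf.ratFnFunctor.obj (op A.base), ζ ^ (M : ℕ) = pull tf.ratFnFunctor b x)
        A₀ hA₀ hA₀').Prop42_iv (fun φ x => tf.pullFracModel φ x) :=
  Prop42Sub.prop42_iii_iv_mkOfModelCanonical_rootsReading X tf hZ hP _ _ _ A₀ hA₀ hA₀' hΦd hDSpull hR hK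
    (mkOfConnectedTemperoid_galoisSurj_natural X tf hZ hP
      (fun _ A M => ∀ (b : A.base ⟶ A₀.base) (x : tf.ratFnFunctor.obj (op A₀.base)),
        divB tf.divisorMonoid tf.ratFnFunctor tf.divBNatTrans (op A₀.base) x = 1 →
          ∃ ζ : tf.ratFnFunctor.obj (op A.base), ζ ^ (M : ℕ) = pull tf.ratFnFunctor b x)
      A₀ hA₀ hA₀')

end General

/-! ## §2 Over the canonical base-category vocabulary `treeCatVocab`: "`Φ` divisorial" is the Def 3.6 (ii) field -/

section TreeCat

variable {K : Type u₀} [Field K] (X : SemiGraphs.TemperedArithmeticGroup.{u₀} K) {D₀ : Type u₀} [Category.{v₀} D₀]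
  {V : FrdIMonoidStub.{w}} {T₀ : RealifiedDivisorMonoids (D₀ := D₀) V}
  {IsRational IsStrictlyRational : ((ConnectedPart (BTemp X.Pi))ᵒᵖ ⥤ CommMonCat.{w}) → Prop}
  (tf : TemperedFrobenioid T₀ (ConnectedPart (BTemp X.Pi))
    (treeCatVocab (ConnectedPart (BTemp X.Pi)) IsRational IsStrictlyRational))
  (hZ : tf.monoidType = MonoidType.Z) (hP : ∀ A : (ConnectedPart (BTemp X.Pi))ᵒᵖ, IsPerfect (tf.Φ.carrier A))
  (NH : Subgroup (Field.absoluteGaloisGroup K) → tf.category → ℕ+ → Prop)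
  (A₀ : tf.category) (hA₀ : PreFrobenioid.IsFrobeniusTrivial tf.toElem A₀) (hA₀' : SemiGraphs.IsGaloisObj A₀.base.obj)

/-- **[EtTh] Prop 4.2 (iii) ∧ (iv) AS TYPED over `B^temp(Π^tp_X)⁰` and the canonical base-category vocabulary
`treeCatVocab`** — "`Φ` divisorial" being the Def 3.6 (ii) field (`TemperedFrobenioid.isDivisorial_divisorMonoid`) and `hS`
the theorem `mkOfConnectedTemperoid_galoisSurj_natural`: ⇐ {`hDSpull`, `hR`, `hE`, `hL`} — four base-level laws of
plan/GAP-LEDGER.md, nothing else. [cite: MochizukiEtTh2009, Prop 4.2 p.88] -/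
theorem Prop42Sub.prop42_iii_iv_mkOfConnectedTemperoid_of_laws_treeCatVocab
    (hDSpull : ∀ {A A' : ConnectedPart (BTemp X.Pi)} (e : A' ⟶ A) {a b : tf.Φ.carrier (op A)},
      (∀ x : tf.Φ.carrier (op A), x ∣ a → x ∣ b → x = 1) →
        ∀ y : tf.Φ.carrier (op A'), y ∣ pull tf.divisorMonoid e a → y ∣ pull tf.divisorMonoid e b → y = 1)
    (hR : ∀ (N : ℕ+) (A : ConnectedPart (BTemp X.Pi)), SemiGraphs.IsGaloisObj A.obj →
      ∀ f : tf.ratFnFunctor.obj (op A),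
        ∃ (A' : ConnectedPart (BTemp X.Pi)) (_ : SemiGraphs.IsGaloisObj A'.obj) (b : A' ⟶ A)
          (g : tf.ratFnFunctor.obj (op A')), g ^ (N : ℕ) = pull tf.ratFnFunctor b f)
    (hE : ∀ (N : ℕ+) (A' : tf.category), PreFrobenioid.IsFrobeniusTrivial tf.toElem A' →
      SemiGraphs.IsGaloisObj A'.base.obj →
        ∃ (A'' : tf.category) (ψ : A'' ⟶ A'), PreFrobenioid.IsPullbackMorphism tf.toElem ψ ∧
          SemiGraphs.IsGaloisObj A''.base.obj ∧ tf.IsMuSaturated A'' N ∧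
            NH (mkOfConnectedTemperoid X tf hZ hP NH A₀ hA₀ hA₀').HodotBsFld A'' N)
    (hL : ∀ (A'' : tf.category) (N : ℕ+) (g : A''.base ⟶ A₀.base) (ξ : tf.ratFnFunctor.obj (op A₀.base)),
      PreFrobenioid.IsFrobeniusTrivial tf.toElem A'' →
      NH (mkOfConnectedTemperoid X tf hZ hP NH A₀ hA₀ hA₀').HodotBsFld A'' N →
      divB tf.divisorMonoid tf.ratFnFunctor tf.divBNatTrans (op A₀.base) ξ = 1 →
        ∃ ζ : tf.ratFnFunctor.obj (op A''.base), ζ ^ (N : ℕ) = pull tf.ratFnFunctor g ξ) :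
    (mkOfConnectedTemperoid X tf hZ hP NH A₀ hA₀ hA₀').Prop42_iii (fun {_ _} φ x => tf.pullFracModel φ x) ∧
      (mkOfConnectedTemperoid X tf hZ hP NH A₀ hA₀ hA₀').Prop42_iv (fun φ x => tf.pullFracModel φ x) :=
  Prop42Sub.prop42_iii_iv_mkOfConnectedTemperoid_of_laws X tf hZ hP NH A₀ hA₀ hA₀' tf.isDivisorial_divisorMonoid hDSpull
    hR hE hL

/-- **The `NH`-free ROOTS-READING floor of [EtTh] Prop 4.2 (iii) ∧ (iv) over `B^temp(Π^tp_X)⁰` and `treeCatVocab`**: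
⇐ {`hDSpull`, `hR`, `hK`} — three base-level laws, no `(N,H)`-saturation parameter, no naturality law, no divisoriality
hypothesis. [cite: MochizukiEtTh2009, Prop 4.2 p.88] -/
theorem Prop42Sub.prop42_iii_iv_mkOfConnectedTemperoid_rootsReading_treeCatVocab
    (hDSpull : ∀ {A A' : ConnectedPart (BTemp X.Pi)} (e : A' ⟶ A) {a b : tf.Φ.carrier (op A)},
      (∀ x : tf.Φ.carrier (op A), x ∣ a → x ∣ b → x = 1) →
        ∀ y : tf.Φ.carrier (op A'), y ∣ pull tf.divisorMonoid e a → y ∣ pull tf.divisorMonoid e b → y = 1)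
    (hR : ∀ (N : ℕ+) (A : ConnectedPart (BTemp X.Pi)), SemiGraphs.IsGaloisObj A.obj →
      ∀ f : tf.ratFnFunctor.obj (op A),
        ∃ (A' : ConnectedPart (BTemp X.Pi)) (_ : SemiGraphs.IsGaloisObj A'.obj) (b : A' ⟶ A)
          (g : tf.ratFnFunctor.obj (op A')), g ^ (N : ℕ) = pull tf.ratFnFunctor b f)
    (hK : ∀ (N : ℕ+) (A' : tf.category), PreFrobenioid.IsFrobeniusTrivial tf.toElem A' →
      SemiGraphs.IsGaloisObj A'.base.obj →
        ∃ (A'' : tf.category) (ψ : A'' ⟶ A'), PreFrobenioid.IsPullbackMorphism tf.toElem ψ ∧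
          SemiGraphs.IsGaloisObj A''.base.obj ∧ tf.IsMuSaturated A'' N ∧
            ∀ (b : A''.base ⟶ A₀.base) (x : tf.ratFnFunctor.obj (op A₀.base)),
              divB tf.divisorMonoid tf.ratFnFunctor tf.divBNatTrans (op A₀.base) x = 1 →
                ∃ ζ : tf.ratFnFunctor.obj (op A''.base), ζ ^ (N : ℕ) = pull tf.ratFnFunctor b x) :
    (mkOfConnectedTemperoid X tf hZ hP
        (fun _ A M => ∀ (b : A.base ⟶ A₀.base) (x : tf.ratFnFunctor.obj (op A₀.base)),
          divB tf.divisorMonoid tf.ratFnFunctor tf.divBNatTrans (op A₀.base) x = 1 →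
            ∃ ζ : tf.ratFnFunctor.obj (op A.base), ζ ^ (M : ℕ) = pull tf.ratFnFunctor b x)
        A₀ hA₀ hA₀').Prop42_iii (fun {_ _} φ x => tf.pullFracModel φ x) ∧
      (mkOfConnectedTemperoid X tf hZ hP
        (fun _ A M => ∀ (b : A.base ⟶ A₀.base) (x : tf.ratFnFunctor.obj (op A₀.base)),
          divB tf.divisorMonoid tf.ratFnFunctor tf.divBNatTrans (op A₀.base) x = 1 →
            ∃ ζ : tf.ratFnFunctor.obj (op A.base), ζ ^ (M : ℕ) = pull tf.ratFnFunctor b x)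
        A₀ hA₀ hA₀').Prop42_iv (fun φ x => tf.pullFracModel φ x) :=
  Prop42Sub.prop42_iii_iv_mkOfConnectedTemperoid_rootsReading X tf hZ hP A₀ hA₀ hA₀' tf.isDivisorial_divisorMonoid
    hDSpull hR hK

end TreeCat

/-! ## §3 Over the canonical [FrdI] vocabularies `treeMonoidVocab` / `treeMonoidVocabWeak`: `hTF` is a THEOREM -/

section TreeVocab

variable {K : Type u₀} [Field K] (X : SemiGraphs.TemperedArithmeticGroup.{u₀} K) {D₀ : Type u₀} [Category.{v₀} D₀]
  {T₀ : RealifiedDivisorMonoids (D₀ := D₀) treeMonoidVocab.{w}}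
  {VD : FrdICatStub.{u₀ + 1, u₀, w} (ConnectedPart (BTemp X.Pi))}
  (tf : TemperedFrobenioid T₀ (ConnectedPart (BTemp X.Pi)) VD) (hZ : tf.monoidType = MonoidType.Z)
  (hP : ∀ A : (ConnectedPart (BTemp X.Pi))ᵒᵖ, IsPerfect (tf.Φ.carrier A))
  (NH : Subgroup (Field.absoluteGaloisGroup K) → tf.category → ℕ+ → Prop)
  (A₀ : tf.category) (hA₀ : PreFrobenioid.IsFrobeniusTrivial tf.toElem A₀) (hA₀' : SemiGraphs.IsGaloisObj A₀.base.obj)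

/-- **[EtTh] Prop 4.2 (iii) ∧ (iv) AS TYPED over `B^temp(Π^tp_X)⁰` and the CANONICAL [FrdI] vocabulary `treeMonoidVocab`,
the root law reduced to `B₀^Λ` with no further input, `hS` DISCHARGED**: ⇐ {`Φ` divisorial, `hDSpull`, `hR₀` (ERRATUM E2
at `B₀^Λ`), `hE`, `hL`} — abc-iut-w4-d044's `…_of_baseRootLaw_treeVocab` (`hTF := pow_injective_ΦR_gp_treeVocab`) with
`hS := mkOfConnectedTemperoid_galoisSurj_natural`. [cite: MochizukiEtTh2009, Prop 4.2 p.88] -/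
theorem Prop42Sub.prop42_iii_iv_mkOfConnectedTemperoid_of_baseRootLaw_treeVocab
    (hΦd : Objectwise (fun M _ => IsDivisorial M) tf.divisorMonoid)
    (hDSpull : ∀ {A A' : ConnectedPart (BTemp X.Pi)} (e : A' ⟶ A) {a b : tf.Φ.carrier (op A)},
      (∀ x : tf.Φ.carrier (op A), x ∣ a → x ∣ b → x = 1) →
        ∀ y : tf.Φ.carrier (op A'), y ∣ pull tf.divisorMonoid e a → y ∣ pull tf.divisorMonoid e b → y = 1)
    (hR₀ : ∀ (N : ℕ+) (A : ConnectedPart (BTemp X.Pi)), SemiGraphs.IsGaloisObj A.obj →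
      ∀ b : T₀.BΛ.obj (op (tf.base.obj A)),
        ∃ (A' : ConnectedPart (BTemp X.Pi)) (_ : SemiGraphs.IsGaloisObj A'.obj) (c : A' ⟶ A)
          (b' : T₀.BΛ.obj (op (tf.base.obj A'))), b' ^ (N : ℕ) = (T₀.BΛ.map (tf.base.map c).op).hom b)
    (hE : ∀ (N : ℕ+) (A' : tf.category), PreFrobenioid.IsFrobeniusTrivial tf.toElem A' →
      SemiGraphs.IsGaloisObj A'.base.obj →
        ∃ (A'' : tf.category) (ψ : A'' ⟶ A'), PreFrobenioid.IsPullbackMorphism tf.toElem ψ ∧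
          SemiGraphs.IsGaloisObj A''.base.obj ∧ tf.IsMuSaturated A'' N ∧
            NH (mkOfConnectedTemperoid X tf hZ hP NH A₀ hA₀ hA₀').HodotBsFld A'' N)
    (hL : ∀ (A'' : tf.category) (N : ℕ+) (g : A''.base ⟶ A₀.base) (ξ : tf.ratFnFunctor.obj (op A₀.base)),
      PreFrobenioid.IsFrobeniusTrivial tf.toElem A'' →
      NH (mkOfConnectedTemperoid X tf hZ hP NH A₀ hA₀ hA₀').HodotBsFld A'' N →
      divB tf.divisorMonoid tf.ratFnFunctor tf.divBNatTrans (op A₀.base) ξ = 1 →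
        ∃ ζ : tf.ratFnFunctor.obj (op A''.base), ζ ^ (N : ℕ) = pull tf.ratFnFunctor g ξ) :
    (mkOfConnectedTemperoid X tf hZ hP NH A₀ hA₀ hA₀').Prop42_iii (fun {_ _} φ x => tf.pullFracModel φ x) ∧
      (mkOfConnectedTemperoid X tf hZ hP NH A₀ hA₀ hA₀').Prop42_iv (fun φ x => tf.pullFracModel φ x) :=
  Prop42Sub.prop42_iii_iv_mkOfModelCanonical_of_baseRootLaw_treeVocab X tf hZ hP _ _ _ NH A₀ hA₀ hA₀' hΦd hDSpull hR₀ hE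
    (mkOfConnectedTemperoid_galoisSurj_natural X tf hZ hP NH A₀ hA₀ hA₀') hL

end TreeVocab

section TreeVocabWeak

variable {K : Type u₀} [Field K] (X : SemiGraphs.TemperedArithmeticGroup.{u₀} K) {D₀ : Type u₀} [Category.{v₀} D₀]
  {T₀ : RealifiedDivisorMonoids (D₀ := D₀) treeMonoidVocabWeak.{w}}
  {VD : FrdICatStub.{u₀ + 1, u₀, w} (ConnectedPart (BTemp X.Pi))}
  (tf : TemperedFrobenioid T₀ (ConnectedPart (BTemp X.Pi)) VD) (hZ : tf.monoidType = MonoidType.Z)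
  (hP : ∀ A : (ConnectedPart (BTemp X.Pi))ᵒᵖ, IsPerfect (tf.Φ.carrier A))
  (NH : Subgroup (Field.absoluteGaloisGroup K) → tf.category → ℕ+ → Prop)
  (A₀ : tf.category) (hA₀ : PreFrobenioid.IsFrobeniusTrivial tf.toElem A₀) (hA₀' : SemiGraphs.IsGaloisObj A₀.base.obj)

/-- **[EtTh] Prop 4.2 (iii) ∧ (iv) AS TYPED over `B^temp(Π^tp_X)⁰` and the WEAK canonical [FrdI] vocabulary
`treeMonoidVocabWeak`** (the vocabulary of record at the tempered coverings `Ÿ`, `Z_∞`, finding F-L2d2-1), `hS` DISCHARGED: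
⇐ {`Φ` divisorial, `hDSpull`, `hR₀`, `hE`, `hL`} — this seat's gen-2 `…_of_baseRootLaw_treeVocabWeak`
(`hTF := pow_injective_ΦR_gp_treeVocabWeak`) with `hS := mkOfConnectedTemperoid_galoisSurj_natural`.
[cite: MochizukiEtTh2009, Prop 4.2 p.88] -/
theorem Prop42Sub.prop42_iii_iv_mkOfConnectedTemperoid_of_baseRootLaw_treeVocabWeak
    (hΦd : Objectwise (fun M _ => IsDivisorial M) tf.divisorMonoid)
    (hDSpull : ∀ {A A' : ConnectedPart (BTemp X.Pi)} (e : A' ⟶ A) {a b : tf.Φ.carrier (op A)},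
      (∀ x : tf.Φ.carrier (op A), x ∣ a → x ∣ b → x = 1) →
        ∀ y : tf.Φ.carrier (op A'), y ∣ pull tf.divisorMonoid e a → y ∣ pull tf.divisorMonoid e b → y = 1)
    (hR₀ : ∀ (N : ℕ+) (A : ConnectedPart (BTemp X.Pi)), SemiGraphs.IsGaloisObj A.obj →
      ∀ b : T₀.BΛ.obj (op (tf.base.obj A)),
        ∃ (A' : ConnectedPart (BTemp X.Pi)) (_ : SemiGraphs.IsGaloisObj A'.obj) (c : A' ⟶ A)
          (b' : T₀.BΛ.obj (op (tf.base.obj A'))), b' ^ (N : ℕ) = (T₀.BΛ.map (tf.base.map c).op).hom b)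
    (hE : ∀ (N : ℕ+) (A' : tf.category), PreFrobenioid.IsFrobeniusTrivial tf.toElem A' →
      SemiGraphs.IsGaloisObj A'.base.obj →
        ∃ (A'' : tf.category) (ψ : A'' ⟶ A'), PreFrobenioid.IsPullbackMorphism tf.toElem ψ ∧
          SemiGraphs.IsGaloisObj A''.base.obj ∧ tf.IsMuSaturated A'' N ∧
            NH (mkOfConnectedTemperoid X tf hZ hP NH A₀ hA₀ hA₀').HodotBsFld A'' N)
    (hL : ∀ (A'' : tf.category) (N : ℕ+) (g : A''.base ⟶ A₀.base) (ξ : tf.ratFnFunctor.obj (op A₀.base)),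
      PreFrobenioid.IsFrobeniusTrivial tf.toElem A'' →
      NH (mkOfConnectedTemperoid X tf hZ hP NH A₀ hA₀ hA₀').HodotBsFld A'' N →
      divB tf.divisorMonoid tf.ratFnFunctor tf.divBNatTrans (op A₀.base) ξ = 1 →
        ∃ ζ : tf.ratFnFunctor.obj (op A''.base), ζ ^ (N : ℕ) = pull tf.ratFnFunctor g ξ) :
    (mkOfConnectedTemperoid X tf hZ hP NH A₀ hA₀ hA₀').Prop42_iii (fun {_ _} φ x => tf.pullFracModel φ x) ∧
      (mkOfConnectedTemperoid X tf hZ hP NH A₀ hA₀ hA₀').Prop42_iv (fun φ x => tf.pullFracModel φ x) :=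
  Prop42Sub.prop42_iii_iv_mkOfModelCanonical_of_baseRootLaw_treeVocabWeak X tf hZ hP _ _ _ NH A₀ hA₀ hA₀' hΦd hDSpull hR₀
    hE (mkOfConnectedTemperoid_galoisSurj_natural X tf hZ hP NH A₀ hA₀ hA₀') hL

end TreeVocabWeak

section TreeCatVocabWeak

variable {K : Type u₀} [Field K] (X : SemiGraphs.TemperedArithmeticGroup.{u₀} K) {D₀ : Type u₀} [Category.{v₀} D₀]
  {T₀ : RealifiedDivisorMonoids (D₀ := D₀) treeMonoidVocabWeak.{w}}
  {IsRational IsStrictlyRational : ((ConnectedPart (BTemp X.Pi))ᵒᵖ ⥤ CommMonCat.{w}) → Prop}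
  (tf : TemperedFrobenioid T₀ (ConnectedPart (BTemp X.Pi))
    (treeCatVocab (ConnectedPart (BTemp X.Pi)) IsRational IsStrictlyRational))
  (hZ : tf.monoidType = MonoidType.Z) (hP : ∀ A : (ConnectedPart (BTemp X.Pi))ᵒᵖ, IsPerfect (tf.Φ.carrier A))
  (NH : Subgroup (Field.absoluteGaloisGroup K) → tf.category → ℕ+ → Prop)
  (A₀ : tf.category) (hA₀ : PreFrobenioid.IsFrobeniusTrivial tf.toElem A₀) (hA₀' : SemiGraphs.IsGaloisObj A₀.base.obj)

/-- **[EtTh] Prop 4.2 (iii) ∧ (iv) AS TYPED over `B^temp(Π^tp_X)⁰` and BOTH weak canonical vocabularies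
(`treeMonoidVocabWeak`, `treeCatVocab`)** — "`Φ` divisorial" the Def 3.6 (ii) field, `hTF` and `hS` theorems:
⇐ {`hDSpull`, `hR₀`, `hE`, `hL`}. [cite: MochizukiEtTh2009, Prop 4.2 p.88] -/
theorem Prop42Sub.prop42_iii_iv_mkOfConnectedTemperoid_of_baseRootLaw_treeCatVocabWeak
    (hDSpull : ∀ {A A' : ConnectedPart (BTemp X.Pi)} (e : A' ⟶ A) {a b : tf.Φ.carrier (op A)},
      (∀ x : tf.Φ.carrier (op A), x ∣ a → x ∣ b → x = 1) →
        ∀ y : tf.Φ.carrier (op A'), y ∣ pull tf.divisorMonoid e a → y ∣ pull tf.divisorMonoid e b → y = 1)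
    (hR₀ : ∀ (N : ℕ+) (A : ConnectedPart (BTemp X.Pi)), SemiGraphs.IsGaloisObj A.obj →
      ∀ b : T₀.BΛ.obj (op (tf.base.obj A)),
        ∃ (A' : ConnectedPart (BTemp X.Pi)) (_ : SemiGraphs.IsGaloisObj A'.obj) (c : A' ⟶ A)
          (b' : T₀.BΛ.obj (op (tf.base.obj A'))), b' ^ (N : ℕ) = (T₀.BΛ.map (tf.base.map c).op).hom b)
    (hE : ∀ (N : ℕ+) (A' : tf.category), PreFrobenioid.IsFrobeniusTrivial tf.toElem A' →
      SemiGraphs.IsGaloisObj A'.base.obj →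
        ∃ (A'' : tf.category) (ψ : A'' ⟶ A'), PreFrobenioid.IsPullbackMorphism tf.toElem ψ ∧
          SemiGraphs.IsGaloisObj A''.base.obj ∧ tf.IsMuSaturated A'' N ∧
            NH (mkOfConnectedTemperoid X tf hZ hP NH A₀ hA₀ hA₀').HodotBsFld A'' N)
    (hL : ∀ (A'' : tf.category) (N : ℕ+) (g : A''.base ⟶ A₀.base) (ξ : tf.ratFnFunctor.obj (op A₀.base)),
      PreFrobenioid.IsFrobeniusTrivial tf.toElem A'' →
      NH (mkOfConnectedTemperoid X tf hZ hP NH A₀ hA₀ hA₀').HodotBsFld A'' N →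
      divB tf.divisorMonoid tf.ratFnFunctor tf.divBNatTrans (op A₀.base) ξ = 1 →
        ∃ ζ : tf.ratFnFunctor.obj (op A''.base), ζ ^ (N : ℕ) = pull tf.ratFnFunctor g ξ) :
    (mkOfConnectedTemperoid X tf hZ hP NH A₀ hA₀ hA₀').Prop42_iii (fun {_ _} φ x => tf.pullFracModel φ x) ∧
      (mkOfConnectedTemperoid X tf hZ hP NH A₀ hA₀ hA₀').Prop42_iv (fun φ x => tf.pullFracModel φ x) :=
  Prop42Sub.prop42_iii_iv_mkOfConnectedTemperoid_of_baseRootLaw_treeVocabWeak X tf hZ hP NH A₀ hA₀ hA₀'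
    tf.isDivisorial_divisorMonoid hDSpull hR₀ hE hL

end TreeCatVocabWeak

end BiKummerSetting

end Literature.AnabelianGeometry.EtaleTheta

end
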